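import Mathlib
import HarnessLib
import Literature.Analysis.FluidPDE.SuitableWeak
import Literature.Analysis.FluidPDE.SelfSimilar
import Literature.Analysis.FluidPDE.LocalTypeI
import Literature.Analysis.FluidPDE.SpaceTimeRescaling
import Literature.Analysis.FluidPDE.LocalTypeIScaling
import Literature.Analysis.FluidPDE.LocalTypeICongr
import Literature.Analysis.FluidPDE.LocalTypeIReverseZoom
import Literature.Analysis.FluidPDE.SlabTypeICompactness
import Literature.Analysis.FluidPDE.TypeIRateOseenMildRepresentative
import Literature.Analysis.FluidPDE.ClassicalTopPointRegularity
import Summits.NavierStokesRegularity.NavierStokesRegularity.Theorems.RellichScarApexLocalisationHullClosed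

/-!
# Sphere persistence: Navier–Stokes images of one rate-Type-I slab profile blowing up at their
# own origin column subconverge to an ORIGIN-SINGULAR continuous rate profile
# (stub `stub_spherePersistence`, line decaying-ancient-bridge of crux RellichScar.ApexLocalisation)

Let `(u, p, G)` be a continuous rate-Type-I suitable weak solution on the backward slab
`𝕊 = (-∞, 0) × ℝ³` (`‖u(t,x)‖ ≤ C/√(−t)`, weak gradient `G`, Albritton–Barker quantity
`𝐈 ≤ I < ⊤`), and let `λ_k > 0`, `x_k ∈ ℝ³`, `t_k < 0` with `t_k → 0` be such that the
Navier–Stokes images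
`w_k(t, x) = λ_k u(λ_k² t, x_k + λ_k x) = (λ_k • stPull (λ_k²) λ_k 0 x_k u) t x`
blow up at their own origin column: `‖w_k(t_k, 0)‖ = λ_k ‖u(λ_k² t_k, x_k)‖ → ∞`.  Then
(`stub_spherePersistence`) along a subsequence the `w_k` converge in `L³(Q(0, R))` for every
`R > 0` to a CONTINUOUS rate-Type-I suitable weak slab profile `(v, q, H)` with `𝐈 ≤ 4 I` which is
singular at the space–time origin.

Proof (Albritton–Barker 2019, Lemma 2.2 + Prop. 2.3 on the slab, i.e. the tree's ENGINE
`slab_typeI_compactness`, plus covariance bookkeeping):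

1. the images `(w_k, λ_k² p∘Φ_k, λ_k² G∘Φ_k)` are suitable weak on the slab with `𝐈 ≤ I`
   (`zoom_isSuitableWeakSolutionOn`, `zoom_hasWeakSpatialGradientOn`,
   `abScaledSum_zoom_le_typeIBound`), continuous on the open slab and keep the rate `C`
   (`continuousOn_hullImage`, `hasTypeITimeDecay_hullImage` with `t₀ = 0`);
2. the ENGINE extracts `σ` and a limit `(v₀, q, H)` with `𝐈 ≤ 4 I` and `w_{σ j} → v₀` in
   `L³(Q(0, R))`;
3. persistence: `w_{σ j}` is continuous on the open ball `Q(0, R) ∋ (t_{σ j}, 0)` for `j` large,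
   so `‖w_{σ j}‖_{L^∞(Q(0,R))} ≥ ‖w_{σ j}(t_{σ j}, 0)‖ → ∞`
   (`enorm_le_eLpNorm_top_restrict_of_continuousOn`), and the ENGINE's persistence clause makes
   the origin a backward singular point of `v₀`;
4. the rate passes to `v₀` a.e. on the slab (a.e.-convergent subsequences on the exhausting balls
   `Q(0, n+1)`), `exists_repr_hasTypeITimeDecay` gives a representative `v₁` with the POINTWISE
   rate, and `exists_oseenMild_repr_of_typeIBound_lt_top` a CONTINUOUS representative `v` keeping
   the rate; suitability, the gradient, `𝐈`, the singular origin and the `L³_loc` convergence are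
   transferred along the a.e. equalities (`IsSuitableWeakSolutionOn.congr_ae`,
   `HasWeakSpatialGradientOn.congr_ae`, `typeIBound_congr_ae`, `IsBackwardSingularPoint.congr_ae`,
   `eLpNorm_congr_ae`).

## References

* D. Albritton, T. Barker, *On local Type I singularities of the Navier–Stokes equations and
  Liouville theorems*, J. Math. Fluid Mech. 21 (2019) = arXiv:1811.00502, Lemma 2.2, Prop. 2.3,
  §3. [AlbrittonBarker2019]
* G. Koch, N. Nadirashvili, G. Seregin, V. Šverák, Acta Math. 203 (2009), (1.4). [KNSS2009]
-/

-- the summit and its single sub-problem share the name (CONVENTIONS §1), as in every Theorems file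
set_option linter.dupNamespace false

namespace Summit.NavierStokesRegularity.NavierStokesRegularity.Theorems.RellichScarApexLocalisation

open MeasureTheory Set Function Metric Filter Topology TopologicalSpace
open scoped ENNReal NNReal
open Literature.Analysis Literature.Analysis.FluidPDE

local notation "E³" => EuclideanSpace ℝ (Fin 3)

/-! ### Tools -/

/-- **`L^∞` blow-up on a fixed ball from pointwise blow-up along a column of points entering it.**
If the fields `W j` are continuous on the open slab, the times `s j < 0` tend to `0`, and
`‖W j (s j) 0‖ → ∞`, then `‖W j‖_{L^∞(Q(0, R))} → ∞` for every `R > 0`: for `j` large the point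
`(s j, 0)` lies in the open ball `Q(0, R)`, where a continuous function is bounded by its essential
supremum (`enorm_le_eLpNorm_top_restrict_of_continuousOn`). -/
theorem tendsto_eLpNorm_top_of_column_blowup {W : ℕ → ℝ → E³ → E³} {s : ℕ → ℝ}
    (hcont : ∀ j, ContinuousOn (uncurry (W j)) (Iio (0 : ℝ) ×ˢ univ))
    (hs : ∀ j, s j < 0) (hs0 : Tendsto s atTop (𝓝 0))
    (hblow : Tendsto (fun j => ‖W j (s j) 0‖) atTop atTop) {R : ℝ} (hR : 0 < R) :
    Tendsto (fun j => eLpNorm (uncurry (W j)) ⊤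
      (volume.restrict (parabolicCylinder R (0 : ℝ × E³)))) atTop (𝓝 ⊤) := by
  have h1 : Tendsto (fun j => ENNReal.ofReal ‖W j (s j) 0‖) atTop (𝓝 ⊤) :=
    ENNReal.tendsto_ofReal_atTop.comp hblow
  refine tendsto_nhds_top_mono h1 ?_
  have hR2 : -R ^ 2 < (0 : ℝ) := by nlinarith
  filter_upwards [hs0.eventually_const_lt hR2] with j hj
  have hmem : ((s j, (0 : E³)) : ℝ × E³) ∈ parabolicCylinder R (0 : ℝ × E³) := by
    rw [mem_parabolicCylinder]
    simp only [Prod.fst_zero, Prod.snd_zero, zero_sub, dist_self]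
    exact ⟨⟨hj, hs j⟩, hR⟩
  have hQs : parabolicCylinder R (0 : ℝ × E³) ⊆ Iio (0 : ℝ) ×ˢ (univ : Set E³) :=
    parabolicCylinder_origin_subset_slab R
  have h2 := enorm_le_eLpNorm_top_restrict_of_continuousOn (μ := (volume : Measure (ℝ × E³)))
    (isOpen_parabolicCylinder R (0 : ℝ × E³)) ((hcont j).mono hQs) hmem
  rw [ofReal_norm]
  exact h2

/-- **The Type-I rate passes to `L³_loc` limits, almost everywhere on the slab.** If measurable
fields `W j` with the rate `‖W j (t, x)‖ ≤ C/√(−t)` converge in `L³(Q(0, n+1))` for every `n` to a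
measurable `v`, then `‖v(t, x)‖ ≤ C/√(−t)` for a.e. `(t, x)` in `(-∞, 0) × ℝ³` (a.e.-convergent
subsequences ball by ball; the balls `Q(0, n+1)` exhaust the slab). -/
theorem ae_rate_of_tendsto_eLpNorm {W : ℕ → ℝ → E³ → E³} {v : ℝ → E³ → E³} {C : ℝ}
    (hWm : ∀ j, AEStronglyMeasurable (uncurry (W j))
      (volume.restrict (Iio (0 : ℝ) ×ˢ (univ : Set E³))))
    (hvm : AEStronglyMeasurable (uncurry v) (volume.restrict (Iio (0 : ℝ) ×ˢ (univ : Set E³))))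
    (hWC : ∀ j, HasTypeITimeDecay C (W j))
    (hL3 : ∀ n : ℕ, Tendsto (fun j => eLpNorm (uncurry (W j) - uncurry v) 3
      (volume.restrict (parabolicCylinder ((n : ℝ) + 1) (0 : ℝ × E³)))) atTop (𝓝 0)) :
    ∀ᵐ z ∂(volume.restrict (Iio (0 : ℝ) ×ˢ (univ : Set E³))),
      ‖v z.1 z.2‖ ≤ C / Real.sqrt (-z.1) := by
  refine ae_restrict_of_ae_restrict_of_subset lowerHalf_subset_iUnion_parabolicCylinder ?_
  rw [ae_restrict_iUnion_iff]
  intro n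
  set Q₀ : Set (ℝ × E³) := parabolicCylinder ((n : ℝ) + 1) (0 : ℝ × E³) with hQ₀
  have hQ₀s : Q₀ ⊆ Iio (0 : ℝ) ×ˢ (univ : Set E³) := parabolicCylinder_origin_subset_slab _
  have hWm' : ∀ j, AEStronglyMeasurable (uncurry (W j)) (volume.restrict Q₀) := fun j =>
    (hWm j).mono_measure (Measure.restrict_mono hQ₀s le_rfl)
  have hvm' : AEStronglyMeasurable (uncurry v) (volume.restrict Q₀) :=
    hvm.mono_measure (Measure.restrict_mono hQ₀s le_rfl)
  have hTIM : TendstoInMeasure (volume.restrict Q₀) (fun j => uncurry (W j)) atTop (uncurry v) :=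
    tendstoInMeasure_of_tendsto_eLpNorm (by norm_num) hWm' hvm' (hL3 n)
  obtain ⟨ns, -, hae⟩ := hTIM.exists_seq_tendsto_ae
  filter_upwards [hae, ae_restrict_mem (isOpen_parabolicCylinder _ _).measurableSet] with z hz hzQ
  have hz0 : z.1 < 0 := (hQ₀s hzQ).1
  exact le_of_tendsto' hz.norm fun i => hWC (ns i) z.1 hz0 z.2

/-- **Transfer of the class data along an a.e. equality on the slab.** If `v₀ = v` a.e. on
`(-∞, 0) × ℝ³`, then suitability, the weak gradient, the bound on `𝐈`, the singular origin and
`L³(Q(0, R))` convergence of a sequence pass from `v₀` to `v` (same pressure and gradient). -/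
theorem classData_congr_ae {v₀ v : ℝ → E³ → E³} {q : ℝ → E³ → ℝ} {H : ℝ → E³ → E³ →L[ℝ] E³}
    {B : ℝ≥0∞} {W : ℕ → ℝ → E³ → E³}
    (hae : ∀ᵐ z ∂(volume.restrict (Iio (0 : ℝ) ×ˢ (univ : Set E³))), uncurry v₀ z = uncurry v z)
    (hsw : IsSuitableWeakSolutionOn (slab E³ (Iio 0) isOpen_Iio) 1 0 v₀ q)
    (hwg : HasWeakSpatialGradientOn (slab E³ (Iio 0) isOpen_Iio) v₀ H)
    (hI : typeIBound (Iio (0 : ℝ) ×ˢ univ) v₀ q H ≤ B)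
    (hsing : IsBackwardSingularPoint v₀ 0)
    (hconv : ∀ R : ℝ, 0 < R → Tendsto (fun j => eLpNorm (uncurry (W j) - uncurry v₀) 3
      (volume.restrict (parabolicCylinder R (0 : ℝ × E³)))) atTop (𝓝 0)) :
    IsSuitableWeakSolutionOn (slab E³ (Iio 0) isOpen_Iio) 1 0 v q ∧
    HasWeakSpatialGradientOn (slab E³ (Iio 0) isOpen_Iio) v H ∧
    typeIBound (Iio (0 : ℝ) ×ˢ univ) v q H ≤ B ∧
    IsBackwardSingularPoint v 0 ∧
    ∀ R : ℝ, 0 < R → Tendsto (fun j => eLpNorm (uncurry (W j) - uncurry v) 3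
      (volume.restrict (parabolicCylinder R (0 : ℝ × E³)))) atTop (𝓝 0) := by
  have hae' : ∀ᵐ z ∂(volume.restrict
      ((slab E³ (Iio 0) isOpen_Iio : Opens (ℝ × E³)) : Set (ℝ × E³))),
      uncurry v₀ z = uncurry v z := by
    rw [coe_slab]
    exact hae
  refine ⟨hsw.congr_ae hae' (ae_of_all _ fun _ => rfl), hwg.congr_ae hae', ?_,
    hsing.congr_ae (fun r _ => parabolicCylinder_origin_subset_slab r) hae, fun R hR => ?_⟩
  · rwa [← typeIBound_congr_ae hae]
  · have haeR : ∀ᵐ z ∂(volume.restrict (parabolicCylinder R (0 : ℝ × E³))),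
        uncurry v₀ z = uncurry v z :=
      ae_restrict_of_ae_restrict_of_subset (parabolicCylinder_origin_subset_slab R) hae
    refine (hconv R hR).congr fun j => eLpNorm_congr_ae ?_
    filter_upwards [haeR] with z hz
    simp only [Pi.sub_apply, hz]

/-! ### The stub -/

/-- **Sphere persistence** (Albritton–Barker 2019 Lemma 2.2 + Prop. 2.3 on the slab, i.e. the tree's
`slab_typeI_compactness`, applied to Navier–Stokes images of ONE profile): let `(u,p,G)` be a
continuous rate-Type-I suitable weak slab profile with `𝐈 ≤ I < ⊤`, and let `λ_k > 0`, `x_k`,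
`t_k < 0`, `t_k → 0` be such that the images `w_k(t,x) = λ_k u(λ_k² t, x_k + λ_k x)` blow up at
their own origin column: `λ_k ‖u(λ_k² t_k, x_k)‖ → ∞`. Then along a subsequence the `w_k` converge
in `L³(Q(0,R))` for every `R > 0` to a continuous rate-Type-I slab profile `(v,q,H)` with `𝐈 ≤ 4I`
which is singular at the space–time origin.
[cite: AlbrittonBarker2019, Lemma 2.2, Prop. 2.3 and §3] -/
theorem stub_spherePersistence :
    ∀ (C : ℝ) (I : ℝ≥0∞) (u : ℝ → E³ → E³) (p : ℝ → E³ → ℝ) (G : ℝ → E³ → E³ →L[ℝ] E³)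
      (lk : ℕ → ℝ) (xk : ℕ → E³) (tk : ℕ → ℝ),
      I < ⊤ →
      IsSuitableWeakSolutionOn (slab E³ (Iio 0) isOpen_Iio) 1 0 u p →
      HasWeakSpatialGradientOn (slab E³ (Iio 0) isOpen_Iio) u G →
      typeIBound (Iio (0 : ℝ) ×ˢ univ) u p G ≤ I →
      HasTypeITimeDecay C u →
      ContinuousOn (uncurry u) (Iio (0 : ℝ) ×ˢ univ) →
      (∀ k, 0 < lk k) → (∀ k, tk k < 0) → Tendsto tk atTop (𝓝 0) →
      Tendsto (fun k => lk k * ‖u (lk k ^ 2 * tk k) (xk k)‖) atTop atTop →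
      ∃ (σ : ℕ → ℕ) (v : ℝ → E³ → E³) (q : ℝ → E³ → ℝ) (H : ℝ → E³ → E³ →L[ℝ] E³),
        StrictMono σ ∧
        IsSuitableWeakSolutionOn (slab E³ (Iio 0) isOpen_Iio) 1 0 v q ∧
        HasWeakSpatialGradientOn (slab E³ (Iio 0) isOpen_Iio) v H ∧
        typeIBound (Iio (0 : ℝ) ×ˢ univ) v q H ≤ 4 * I ∧
        HasTypeITimeDecay C v ∧
        ContinuousOn (uncurry v) (Iio (0 : ℝ) ×ˢ univ) ∧
        IsBackwardSingularPoint v 0 ∧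
        ∀ R : ℝ, 0 < R → Tendsto (fun j => eLpNorm
          (uncurry (lk (σ j) • stPull (lk (σ j) ^ 2) (lk (σ j)) 0 (xk (σ j)) u) - uncurry v) 3
          (volume.restrict (parabolicCylinder R (0 : ℝ × E³)))) atTop (𝓝 0) := by
  intro C I u p G lk xk tk hI hsw hwg hIle hC hcont hlk htk htk0 hblow
  -- ## Step 0: `0 ≤ C` (the rate at `(t, x) = (-1, 0)`)
  have hC0 : 0 ≤ C := by
    have h := hC (-1) (by norm_num) 0
    rw [neg_neg, Real.sqrt_one, div_one] at h
    exact (norm_nonneg _).trans h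
  -- ## Step 1: the images and their class data
  set w : ℕ → ℝ → E³ → E³ := fun k => lk k • stPull (lk k ^ 2) (lk k) 0 (xk k) u with hw
  set qk : ℕ → ℝ → E³ → ℝ := fun k => lk k ^ 2 • stPull (lk k ^ 2) (lk k) 0 (xk k) p with hqk
  set Gk : ℕ → ℝ → E³ → E³ →L[ℝ] E³ :=
    fun k => lk k ^ 2 • stPull (lk k ^ 2) (lk k) 0 (xk k) G with hGk
  have hle : ∀ k, (slab E³ (Iio 0) isOpen_Iio) ≤
      stPreimage (lk k ^ 2) (lk k) 0 (xk k) (slab E³ (Iio 0) isOpen_Iio) := fun k =>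
    slab_le_stPreimage_hullImage le_rfl (hlk k) _
  have hswk : ∀ k, IsSuitableWeakSolutionOn (slab E³ (Iio 0) isOpen_Iio) 1 0 (w k) (qk k) :=
    fun k => (zoom_isSuitableWeakSolutionOn hsw (hlk k) 0 (xk k)).of_le (hle k)
  have hwgk : ∀ k, HasWeakSpatialGradientOn (slab E³ (Iio 0) isOpen_Iio) (w k) (Gk k) :=
    fun k => (zoom_hasWeakSpatialGradientOn hwg (hlk k) 0 (xk k)).mono (hle k)
  have hIk : ∀ k, typeIBound (Iio (0 : ℝ) ×ˢ univ) (w k) (qk k) (Gk k) ≤ I := fun k =>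
    (typeIBound_le_iff.2 fun r hr z hz =>
      abScaledSum_zoom_le_typeIBound (hlk k) le_rfl (xk k) hr
        (fst_nonpos_of_parabolicCylinder_subset_lowerHalf hr hz)).trans hIle
  have hwcont : ∀ k, ContinuousOn (uncurry (w k)) (Iio (0 : ℝ) ×ˢ univ) := fun k =>
    continuousOn_hullImage hcont le_rfl (hlk k)
  have hwC : ∀ k, HasTypeITimeDecay C (w k) := fun k =>
    hasTypeITimeDecay_hullImage hC le_rfl (hlk k)
  have hval : ∀ k, ‖w k (tk k) 0‖ = lk k * ‖u (lk k ^ 2 * tk k) (xk k)‖ := fun k => by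
    simp only [hw, smul_stPull_apply, smul_zero, add_zero, zero_add, norm_smul,
      Real.norm_of_nonneg (hlk k).le]
  -- ## Step 2: the ENGINE
  obtain ⟨v₀, q, H, σ, hσ, hsw₀, hwg₀, hI₀, hconv₀, hpers₀⟩ :=
    slab_typeI_compactness I w qk Gk hI hswk hwgk hIk
  -- ## Step 3: persistence — the images blow up in `L^∞(Q(0, R))` for every `R > 0`
  have hsing₀ : IsBackwardSingularPoint v₀ 0 := by
    refine hpers₀ fun R hR => Tendsto.limsup_eq ?_
    refine tendsto_eLpNorm_top_of_column_blowup (W := fun j => w (σ j)) (s := fun j => tk (σ j))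
      (fun j => hwcont (σ j)) (fun j => htk (σ j)) (htk0.comp hσ.tendsto_atTop) ?_ hR
    have h := hblow.comp hσ.tendsto_atTop
    refine h.congr fun j => ?_
    simp only [Function.comp_apply, hval]
  -- ## Step 4: the rate a.e. for the limit, and a representative with the pointwise rate
  have hrate₀ : ∀ᵐ z ∂(volume.restrict (Iio (0 : ℝ) ×ˢ (univ : Set E³))),
      ‖v₀ z.1 z.2‖ ≤ C / Real.sqrt (-z.1) :=
    ae_rate_of_tendsto_eLpNorm (W := fun j => w (σ j))
      (fun j => (hwgk (σ j)).locallyIntegrableOn.aestronglyMeasurable)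
      hwg₀.locallyIntegrableOn.aestronglyMeasurable (fun j => hwC (σ j))
      (fun n => hconv₀ ((n : ℝ) + 1) (by positivity))
  obtain ⟨v₁, hae₁, hC₁⟩ := exists_repr_hasTypeITimeDecay hC0 hrate₀
  obtain ⟨hsw₁, hwg₁, hI₁, hsing₁, hconv₁⟩ := classData_congr_ae hae₁ hsw₀ hwg₀ hI₀ hsing₀ hconv₀
  -- ## Step 5: the continuous (Oseen-mild) representative, keeping the rate
  have hI₁top : typeIBound (Iio (0 : ℝ) ×ˢ univ) v₁ q H < ⊤ :=
    lt_of_le_of_lt hI₁ (ENNReal.mul_lt_top (by simp) hI)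
  obtain ⟨v, hae₂, hvcont, -, -, hvC⟩ := exists_oseenMild_repr_of_typeIBound_lt_top hsw₁ hC₁ hI₁top
  obtain ⟨hswv, hwgv, hIv, hsingv, hconvv⟩ := classData_congr_ae hae₂ hsw₁ hwg₁ hI₁ hsing₁ hconv₁
  exact ⟨σ, v, q, H, hσ, hswv, hwgv, hIv, hvC, hvcont, hsingv, fun R hR => hconvv R hR⟩

end Summit.NavierStokesRegularity.NavierStokesRegularity.Theorems.RellichScarApexLocalisation
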